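import Summits.BirchSwinnertonDyer.Rank1Residual.WAll.TargetCMTwoSlices
import Summits.BirchSwinnertonDyer.Rank1Residual.P2.WindowsAtTwo
import Summits.BirchSwinnertonDyer.Rank1Residual.P2.CellsAtTwo
import Literature.NumberTheory.EllipticCurves.HeathBrown1994.CongruentTwoSelmerMonskyMatrix
import Literature.NumberTheory.EllipticCurves.FaulknerJames2007.RhoIndexEvenPartitionBound
import Literature.NumberTheory.EllipticCurves.TianYuanZhang2017.GenusFieldFamily
import HarnessLib
import HarnessLib.Audit.Tags

/-!
# Rung W-ALL of ladder BSD (D-0120) — the RAMIFIED slice of row 12₂ (`WAllCornerFTwoRamified`: CM,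
# `r = 1`, `2 ∣ d_K`) SLICED by the congruent-number FAMILIES of the Tian–Yuan–Zhang road (cell
# `bsd-print-cf2`, D-0131 (2) PRINT TIER, seat `p1`): three family leaves + the residual BY NAME

HONEST FRAMING (cell `bsd-print-cf2`, run/shared/lean/pub/bsd-print-cf2/; partition leaf «CornerF @
`p = 2`» = `Summit.BirchSwinnertonDyer.WAllCornerFTwo`; its ramified slice
`Summit.BirchSwinnertonDyer.WAllCornerFTwoRamified` of `WAll/TargetCMTwoSlices.lean` (seat p4, p532371)
contains every congruent-number curve `E_m : y² = x³ − m²x` of analytic rank one): STATEMENTS AND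
BOOKKEEPING ONLY — nothing asserted, nothing booked, no named fact introduced, no published theorem
restated. Every `@[conjecture] def` below is an obligation and a SLICE of `WAllCornerFTwoRamified`, cut
by MEMBERSHIP in explicit families of quadratic twists `E_m` (up to `ℚ`-isomorphism of globally minimal
models, `∃ C, C • congruentNumberCurve m = W`), exactly as `WAll/TargetAtTwoThetaSlices.lean` cuts row 1 by a
habitat; the cut is excluded middle on membership, so every glue theorem is unconditional logic.

WHY (seat `bsd-print-cf2-p1`, strategy «Tian–Yuan–Zhang induction BY NAME: Heegner points + genus theory
+ Gross–Zagier/Waldspurger ⇒ 2-part of BSD for `E_n` with controlled prime factorisations (Tian 2014;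
Tian–Yuan–Zhang 2017), typed as class theorems on explicit infinite families»). The three membership
predicates below are the UNIONS of the families on which the tree PROVES `BSD(E_m, 2)` modulo named
published facts (sub-lane «bsd-p2» and `Literature/…/{Tian2014,TianYuanZhang2017,LiLiuTian2024}/*`),
grouped by the cell referee's pre-landing verdict (HOME STATUS 2026-08-27T12:49:43Z):
* `CongruentTYZProvedFamily` — flag-free binders (TYZ17 Thm 1.2 AS PRINTED, Tian14 Thm 1.3,
  Rédei–Reichardt, LLT24 Thm 1.2, Monsky90 Cor 5.15 (2), GZK, Cassels, modularity): LLT (Li–Liu–Tian 2024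
  Thm 1.2: `n ≡ 5 (8)`, all `q ∣ n` `≡ 1 (4)`, no ideal class of order `4`; IN PRINT, full BSD), T5
  (`n = ∏ pᵢ ≡ 5 (8)`, all `pᵢ ≡ 1 (4)`, odd Legendre graph; print via LLT + Rédei–Reichardt), T7 (Tian
  2014 class 7: `p₀ ≡ 7`, `pᵢ ≡ 1 (8)`, odd graph; beyond print), M35 (`E_{pq}`, `p ≡ 3`, `q ≡ 5 (8)`;
  beyond print), TYZρ (square-free `n ≡ 5, 7 (8)` with `#Sel₂(E_n) = 8`, `ρ(n) = 0` and an odd genus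
  sum — Tian–Yuan–Zhang Thm 1.2 / Tian ICM 2022 Thm 13 as a CLASS; beyond print as an assembly);
* `CongruentTYZUPlusFamily` — binder `tyz_genusPointData` (TYZ §3 displayed, ∃-fact A312: the referee
  books its consumers LITERAL-by-name): T6 (Tian 2014 class 6: `E_{2n}`, `p₀ ≡ 3 (4)`, `pᵢ ≡ 1 (8)`, odd
  graph), TYZ-U⁺ (`#Sel₂ = 8` + the printed genus condition of the class of `n`, no `ρ`: the per-`n`
  content of Tian ICM 2022 Thm 8), A37 («bsd-p2» `ω = 3` atlas, class 7, `s(n) = 1` alone);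
* `CongruentTYZAtlasFJFamily` — `ω = 3`, class 7, Monsky kernel `2` AND Faulkner–James kernel `4`
  (`ρ = 0` road; binders TYZ Thm 1.2′, HB94 Monsky odd, Rédei–Reichardt, GZK — no A312).
The closers (`…_of_facts : facts → leaf`) land in the sibling proof files
`WAll/AltClosersCMTwoRamifiedFamilies.lean` / `…GenusClass.lean` (seat p1). The fourth leaf
`WAllCornerFTwoRamifiedOffTYZ` is the RESIDUAL of the ramified slice off these families, BY NAME
(verbatim consumable as a route's residual item, bsd-wall TYPING-CHECKLIST T7).

CONTENTS. §1 the three membership predicates; §2 the four slice leaves; §3 glue —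
`wAllCornerFTwoRamified_iff_tyzSlices` (ramified slice ⟺ its four sub-slices, EXACT), each leaf ⇐
`WAllCornerFTwoRamified` ⇐ `WAllCornerFTwo` ⇐ `WAll`.

References: `WAll/TargetCMTwoSlices.lean` (p4), `WAll/Target.lean`; sub-lane «bsd-p2»
`P2/WindowsAtTwo.lean` (`CongruentFamilyLLT`), `P2/TianFamilySevenAtTwo.lean`,
`P2/CongruentNumberPairsAtTwoGenusPointData.lean`, `P2/CongruentNumberPairsAtTwoThreeFiveFamilyPrinted.lean`,
`P2/CongruentNumberPairsAtTwoDoorAAtlasThree.lean`, `P2/CongruentClassSevenKernelGenusParity.lean`;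
`Literature/…/Tian2014/ClassFiveFamilyDescentProofs.lean`. [cite: Tian2014, Thm. 1.3, Lemma 5.1, Rem. 1.4]
[cite: TianYuanZhang2017, Thm. 1.2, §3] [cite: LiLiuTian2024, Thm. 1.2] [cite: Tian2023CongruentICM, Thm. 2,
Thm. 8, Thm. 13] [cite: Miller2011LMS, §1 and Def. 1.1].
-/

noncomputable section

open scoped Classical

open Matrix WeierstrassCurve Literature.NumberTheory.EllipticCurves
  Literature.NumberTheory.EllipticCurves.Rank1Residual
  Literature.NumberTheory.EllipticCurves.HeathBrown1994
  Literature.NumberTheory.EllipticCurves.TianYuanZhang2017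
  Literature.NumberTheory.EllipticCurves.FaulknerJames2007
open Summit.BirchSwinnertonDyer.Rank1Residual

set_option autoImplicit false

namespace Summit.BirchSwinnertonDyer

/-! ### §1. Membership predicates: the families of the Tian–Yuan–Zhang road (up to `ℚ`-isomorphism) -/

/-- **The flag-free TYZ families** (referee 12:49:43Z: PROVED item). `W` is a `ℚ`-model of `E_m` with `m` in:
LLT (`P2.CongruentFamilyLLT`) ∨ T5 (`n = ∏ pᵢ ≡ 5 (8)`, all `pᵢ ≡ 1 (4)`, odd Legendre graph in Monsky's
kernel form) ∨ T7 (Tian 2014 class 7) ∨ M35 (`pq`, `p ≡ 3`, `q ≡ 5 (8)`) ∨ TYZρ (square-free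
`n ≡ 5, 7 (8)`, `#Sel₂(E_n) = 8`, `[E_n(ℚ) : φ_n(A_n(ℚ)) + E_n[2]] = 1`, `Σ₁(n)` or `Σ₂′(n)` odd over
`K_d = GenusField d`). A class predicate (`P2.ClassAtTwo`, as `P2.CongruentFamilyLLT`); nothing asserted. [cite: LiLiuTian2024, Thm. 1.2]
[cite: Tian2014, Thm. 1.3 and Lemma 5.1] [cite: TianYuanZhang2017, Thm. 1.2 and §1 (ρ(n), g(d))]
[cite: Monsky1990MockHeegner, Cor. 5.15 (2) (p. 66)] -/
def CongruentTYZProvedFamily : P2.ClassAtTwo := fun W _ _ =>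
  P2.CongruentFamilyLLT W ∨
  (∃ (k : ℕ) (p : Fin (k + 1) → ℕ), (∀ i, (p i).Prime) ∧ Function.Injective p ∧ (∀ i, p i % 4 = 1) ∧
    (∏ i, p i) % 8 = 5 ∧ (∀ v, legendreMatrix p *ᵥ v = 0 → v = 0 ∨ v = fun _ => 1) ∧
    ∃ C : VariableChange ℚ, C • congruentNumberCurve (∏ i, p i) = W) ∨
  (∃ (k : ℕ) (p : Fin (k + 1) → ℕ), (∀ i, (p i).Prime) ∧ Function.Injective p ∧ p 0 % 8 = 7 ∧
    (∀ i, i ≠ 0 → p i % 8 = 1) ∧ (∀ v, legendreMatrix p *ᵥ v = 0 → v = 0 ∨ v = fun _ => 1) ∧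
    ∃ C : VariableChange ℚ, C • congruentNumberCurve (∏ i, p i) = W) ∨
  (∃ (p q : ℕ), p.Prime ∧ q.Prime ∧ p % 8 = 3 ∧ q % 8 = 5 ∧
    ∃ C : VariableChange ℚ, C • congruentNumberCurve (p * q) = W) ∨
  (∃ (n : ℕ) (hsq : Squarefree n), (n % 8 = 5 ∨ n % 8 = 7) ∧
    (haveI := isElliptic_congruentNumberCurve hsq.ne_zero;
      Nat.card ((congruentNumberCurve n).selmerGroup 2) = 8) ∧
    (rhoSubgroup n).index = 1 ∧
    (Odd (genusSum₁ n fun d => genusClassNumber (GenusField d)) ∨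
      Odd (genusSum₂' n fun d => genusClassNumber (GenusField d))) ∧
    ∃ C : VariableChange ℚ, C • congruentNumberCurve n = W)

/-- **The U⁺-road TYZ families** (referee 12:49:43Z: LITERAL item, binder `tyz_genusPointData`). `W` is a
`ℚ`-model of `E_m` with `m` in: T6 (Tian 2014 class 6: `2 ∏ pᵢ`, `p₀ ≡ 3 (4)`, `pᵢ ≡ 1 (8)` for `i ≥ 1`,
odd graph) ∨ TYZ-U⁺ (square-free `n`, `#Sel₂(E_n) = 8`, and `Σ₁` or `Σ₂′` odd if `n ≡ 5, 7 (8)`, `Σ₂′` odd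
if `n ≡ 6 (8)`) ∨ A37 (three distinct primes, product `≡ 7 (8)`, Monsky's matrix with a `2`-element
kernel). A predicate; nothing asserted. [cite: Tian2014, Thm. 1.3, Lemma 5.1, Thm. 5.2]
[cite: TianYuanZhang2017, Thm. 1.2, Prop. 3.4, Thm. 3.5] [cite: Tian2023CongruentICM, Thm. 8 and Thm. 13]
[cite: HeathBrown1994SelmerCongruentII, Appendix (Monsky), typescript p. 39] -/
def CongruentTYZUPlusFamily : P2.ClassAtTwo := fun W _ _ =>
  (∃ (k : ℕ) (p : Fin (k + 1) → ℕ), (∀ i, (p i).Prime) ∧ Function.Injective p ∧ p 0 % 4 = 3 ∧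
    (∀ i, i ≠ 0 → p i % 8 = 1) ∧ (∀ v, legendreMatrix p *ᵥ v = 0 → v = 0 ∨ v = fun _ => 1) ∧
    ∃ C : VariableChange ℚ, C • congruentNumberCurve (2 * ∏ i, p i) = W) ∨
  (∃ (n : ℕ) (hsq : Squarefree n),
    (haveI := isElliptic_congruentNumberCurve hsq.ne_zero;
      Nat.card ((congruentNumberCurve n).selmerGroup 2) = 8) ∧
    (((n % 8 = 5 ∨ n % 8 = 7) ∧
        (Odd (genusSum₁ n fun d => genusClassNumber (GenusField d)) ∨
          Odd (genusSum₂' n fun d => genusClassNumber (GenusField d)))) ∨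
      (n % 8 = 6 ∧ Odd (genusSum₂' n fun d => genusClassNumber (GenusField d)))) ∧
    ∃ C : VariableChange ℚ, C • congruentNumberCurve n = W) ∨
  (∃ (p : Fin 3 → ℕ), (∀ i, (p i).Prime) ∧ Function.Injective p ∧ (∏ i, p i) % 8 = 7 ∧
    Fintype.card {v : Fin 3 ⊕ Fin 3 → ZMod 2 // monskyMatrixOdd p *ᵥ v = 0} = 2 ∧
    ∃ C : VariableChange ℚ, C • congruentNumberCurve (∏ i, p i) = W)

/-- **The `ω = 3` atlas on the `ρ = 0` road** (flag-free binders TYZ Thm 1.2′, HB94 Monsky odd,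
Rédei–Reichardt, GZK): three distinct primes, product `≡ 7 (8)`, Monsky kernel `2` AND Faulkner–James
Laplacian kernel `4` (⇒ `ρ = 0`, tree `rhoIndex_eq_one_of_card_ker`). A predicate; nothing asserted.
[cite: TianYuanZhang2017, Thm. 1.2 (as printed)] [cite: FaulknerJames2007, Thm. 1.2 (2)]
[cite: HeathBrown1994SelmerCongruentII, Appendix (Monsky), typescript p. 39] -/
def CongruentTYZAtlasFJFamily : P2.ClassAtTwo := fun W _ _ =>
  ∃ (p : Fin 3 → ℕ), (∀ i, (p i).Prime) ∧ Function.Injective p ∧ (∏ i, p i) % 8 = 7 ∧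
    Fintype.card {v : Fin 3 ⊕ Fin 3 → ZMod 2 // monskyMatrixOdd p *ᵥ v = 0} = 2 ∧
    Fintype.card {v : Fin (3 + 1) → ZMod 2 // fjLaplacianNeg p *ᵥ v = 0} = 4 ∧
    ∃ C : VariableChange ℚ, C • congruentNumberCurve (∏ i, p i) = W

/-! ### §2. The ramified slice of row 12₂ cut by the TYZ families: four leaves -/

/-- **Ramified slice ON THE FLAG-FREE TYZ FAMILIES** (closed modulo named facts by
`wAllCornerFTwoRamifiedTYZProved_of_facts`, sibling AltClosers file): CM, `ord_{s=1} L(E,s) = 1`, `2 ∣ d_K`,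
`W ∈ CongruentTYZProvedFamily` ⇒ `BSD(E,2)`. [folklore] -/
@[conjecture] def WAllCornerFTwoRamifiedTYZProved : Prop :=
  ∀ (W : WeierstrassCurve ℚ) [W.IsElliptic] [W.IsGloballyMinimal],
    W.HasCM → W.analyticRank = 1 → CMRamified W 2 → CongruentTYZProvedFamily W → BSDp W 2

/-- **Ramified slice ON THE U⁺-ROAD TYZ FAMILIES** (closed modulo named facts incl. `tyz_genusPointData` by
`wAllCornerFTwoRamifiedTYZUPlus_of_facts`): CM, `r = 1`, `2 ∣ d_K`, `W ∈ CongruentTYZUPlusFamily` ⇒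
`BSD(E,2)`. [folklore] -/
@[conjecture] def WAllCornerFTwoRamifiedTYZUPlus : Prop :=
  ∀ (W : WeierstrassCurve ℚ) [W.IsElliptic] [W.IsGloballyMinimal],
    W.HasCM → W.analyticRank = 1 → CMRamified W 2 → CongruentTYZUPlusFamily W → BSDp W 2

/-- **Ramified slice ON THE `ω = 3` FJ ATLAS** (closed modulo named facts by
`wAllCornerFTwoRamifiedTYZAtlasFJ_of_facts`): CM, `r = 1`, `2 ∣ d_K`, `W ∈ CongruentTYZAtlasFJFamily` ⇒
`BSD(E,2)`. [folklore] -/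
@[conjecture] def WAllCornerFTwoRamifiedTYZAtlasFJ : Prop :=
  ∀ (W : WeierstrassCurve ℚ) [W.IsElliptic] [W.IsGloballyMinimal],
    W.HasCM → W.analyticRank = 1 → CMRamified W 2 → CongruentTYZAtlasFJFamily W → BSDp W 2

/-- **Ramified slice OFF THE TYZ FAMILIES — THE RESIDUAL OF THE p1 ROAD, BY NAME (OPEN).** CM,
`ord_{s=1} L(E,s) = 1`, `2 ∣ d_K` (`K ∈ {ℚ(i), ℚ(√−2)}`), and `W` is a `ℚ`-model of NO member of the three
families ⇒ `BSD(E,2)`. Contains: every `j = 1728` curve of analytic rank one that is not a quadratic twist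
`E_m` of `y² = x³ − x` in the families (all quartic twists `y² = x³ + Dx` with `−D` not a square; the
congruent-number curves `E_m` with `s(m) ≥ 3`, or with `s(m) = 1` but even genus sums, or outside the
Rédei shapes — e.g. Monsky's 𝒮⁻ family of ladder row M lies here unless carved out by its own route),
every `j = 287496` curve, and every `K = ℚ(√−2)` curve (`j = 8000`). No theorem in print. [folklore] -/
@[conjecture] def WAllCornerFTwoRamifiedOffTYZ : Prop :=
  ∀ (W : WeierstrassCurve ℚ) [W.IsElliptic] [W.IsGloballyMinimal],
    W.HasCM → W.analyticRank = 1 → CMRamified W 2 →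
      ¬ CongruentTYZProvedFamily W → ¬ CongruentTYZUPlusFamily W → ¬ CongruentTYZAtlasFJFamily W →
      BSDp W 2

/-! ### §3. Glue (excluded middle on membership only) -/

/-- **The ramified slice of row 12₂ ⟺ its four TYZ sub-slices** (EXACT; pure logic). [folklore] -/
theorem wAllCornerFTwoRamified_iff_tyzSlices :
    WAllCornerFTwoRamified ↔
      WAllCornerFTwoRamifiedTYZProved ∧ WAllCornerFTwoRamifiedTYZUPlus ∧
        WAllCornerFTwoRamifiedTYZAtlasFJ ∧ WAllCornerFTwoRamifiedOffTYZ := by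
  constructor
  · intro h
    exact ⟨fun W _ _ hcm hr1 hram _ ↦ h W hcm hr1 hram, fun W _ _ hcm hr1 hram _ ↦ h W hcm hr1 hram,
      fun W _ _ hcm hr1 hram _ ↦ h W hcm hr1 hram, fun W _ _ hcm hr1 hram _ _ _ ↦ h W hcm hr1 hram⟩
  · rintro ⟨hP, hU, hF, hO⟩ W _ _ hcm hr1 hram
    by_cases h1 : CongruentTYZProvedFamily W
    · exact hP W hcm hr1 hram h1
    · by_cases h2 : CongruentTYZUPlusFamily W
      · exact hU W hcm hr1 hram h2
      · by_cases h3 : CongruentTYZAtlasFJFamily W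
        · exact hF W hcm hr1 hram h3
        · exact hO W hcm hr1 hram h1 h2 h3

/-- The ramified slice from its four TYZ sub-slices. [folklore] -/
theorem wAllCornerFTwoRamified_of_tyzSlices (hP : WAllCornerFTwoRamifiedTYZProved)
    (hU : WAllCornerFTwoRamifiedTYZUPlus) (hF : WAllCornerFTwoRamifiedTYZAtlasFJ)
    (hO : WAllCornerFTwoRamifiedOffTYZ) : WAllCornerFTwoRamified :=
  wAllCornerFTwoRamified_iff_tyzSlices.2 ⟨hP, hU, hF, hO⟩

/-- **After the closers: the ramified slice IS its residual off the TYZ families**, granted the three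
family leaves (which the AltClosers files derive from named facts). [folklore] -/
theorem wAllCornerFTwoRamified_iff_offTYZ_of_families (hP : WAllCornerFTwoRamifiedTYZProved)
    (hU : WAllCornerFTwoRamifiedTYZUPlus) (hF : WAllCornerFTwoRamifiedTYZAtlasFJ) :
    WAllCornerFTwoRamified ↔ WAllCornerFTwoRamifiedOffTYZ :=
  ⟨fun h ↦ (wAllCornerFTwoRamified_iff_tyzSlices.1 h).2.2.2,
    fun hO ↦ wAllCornerFTwoRamified_of_tyzSlices hP hU hF hO⟩

/-- Conversely the ramified slice restricts to all four. [folklore] -/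
theorem tyzSlices_of_wAllCornerFTwoRamified (h : WAllCornerFTwoRamified) :
    WAllCornerFTwoRamifiedTYZProved ∧ WAllCornerFTwoRamifiedTYZUPlus ∧
      WAllCornerFTwoRamifiedTYZAtlasFJ ∧ WAllCornerFTwoRamifiedOffTYZ :=
  wAllCornerFTwoRamified_iff_tyzSlices.1 h

/-- … and all four follow from row 12₂ (`WAllCornerFTwo`). [folklore] -/
theorem tyzSlices_of_wAllCornerFTwo (h : WAllCornerFTwo) :
    WAllCornerFTwoRamifiedTYZProved ∧ WAllCornerFTwoRamifiedTYZUPlus ∧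
      WAllCornerFTwoRamifiedTYZAtlasFJ ∧ WAllCornerFTwoRamifiedOffTYZ :=
  tyzSlices_of_wAllCornerFTwoRamified (wAllCornerFTwo_iff_slices.1 h).2.2.1

/-- … and from `WAll`. [folklore] -/
theorem tyzSlices_of_wAll (h : WAll) :
    WAllCornerFTwoRamifiedTYZProved ∧ WAllCornerFTwoRamifiedTYZUPlus ∧
      WAllCornerFTwoRamifiedTYZAtlasFJ ∧ WAllCornerFTwoRamifiedOffTYZ :=
  tyzSlices_of_wAllCornerFTwoRamified (cmTwoSlices_of_wAll h).2.2.1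

/-- **Row 12₂ with the TYZ families carved out**: `WAllCornerFTwo` ⟺ split-good ∧ split-bad ∧ (the three
TYZ family leaves ∧ the ramified residual off them) ∧ inert-good ∧ inert-bad. [folklore] -/
theorem wAllCornerFTwo_iff_slices_tyz :
    WAllCornerFTwo ↔ WAllCornerFTwoSplitGood ∧ WAllCornerFTwoSplitBad ∧
      (WAllCornerFTwoRamifiedTYZProved ∧ WAllCornerFTwoRamifiedTYZUPlus ∧
        WAllCornerFTwoRamifiedTYZAtlasFJ ∧ WAllCornerFTwoRamifiedOffTYZ) ∧
      WAllCornerFTwoInertGood ∧ WAllCornerFTwoInertBad := by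
  rw [wAllCornerFTwo_iff_slices, wAllCornerFTwoRamified_iff_tyzSlices]

/-! ### §4. The families lie in the ramified slice (membership ⟹ CM, `2 ∣ d_K`) -/

/-- A `ℚ`-model of a congruent-number twist `E_m` (`m ≠ 0`) has CM by `ℤ[i]` and `2` ramified in its
CM field (`j = 1728`, `d_K = −4`). [cite: Cox2013, §5.B Prop. 5.16 and Cor. 5.17] -/
theorem hasCM_and_cmRamified_two_of_smul_congruentNumberCurve {m : ℕ} (hm : m ≠ 0)
    {W : WeierstrassCurve ℚ} [W.IsElliptic] {C : VariableChange ℚ}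
    (hC : C • congruentNumberCurve m = W) : W.HasCM ∧ CMRamified W 2 := by
  haveI := isElliptic_congruentNumberCurve hm
  subst hC
  have hj : (C • congruentNumberCurve m).j = 1728 := by rw [variableChange_j, congruentNumberCurve_j]
  refine ⟨hasCM_of_j_eq_1728 _ hj, ?_⟩
  show (2 : ℤ) ∣ cmFieldDiscrOfJ (C • congruentNumberCurve m).j
  rw [hj, cmFieldDiscrOfJ]; norm_num

/-- Every member of `CongruentTYZProvedFamily` has CM with `2` ramified (the family lies in the ramified
slice; its analytic rank is `1` by the facts, see the AltClosers file). [folklore] -/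
theorem hasCM_and_cmRamified_two_of_congruentTYZProvedFamily {W : WeierstrassCurve ℚ} [W.IsElliptic]
    [W.IsGloballyMinimal] (h : CongruentTYZProvedFamily W) : W.HasCM ∧ CMRamified W 2 := by
  rcases h with ⟨n, hsq, -, -, -, C, hC⟩ | ⟨k, p, hp, hinj, -, -, -, C, hC⟩ | ⟨k, p, hp, hinj, -, -, -, C, hC⟩ |
      ⟨p, q, hp, hq, -, -, C, hC⟩ | ⟨n, hsq, -, -, -, -, C, hC⟩
  · exact hasCM_and_cmRamified_two_of_smul_congruentNumberCurve hsq.ne_zero hC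
  · exact hasCM_and_cmRamified_two_of_smul_congruentNumberCurve
      (squarefree_prod_of_injective p hp hinj).ne_zero hC
  · exact hasCM_and_cmRamified_two_of_smul_congruentNumberCurve
      (squarefree_prod_of_injective p hp hinj).ne_zero hC
  · exact hasCM_and_cmRamified_two_of_smul_congruentNumberCurve (Nat.mul_ne_zero hp.ne_zero hq.ne_zero) hC
  · exact hasCM_and_cmRamified_two_of_smul_congruentNumberCurve hsq.ne_zero hC

/-- Every member of `CongruentTYZUPlusFamily` has CM with `2` ramified. [folklore] -/
theorem hasCM_and_cmRamified_two_of_congruentTYZUPlusFamily {W : WeierstrassCurve ℚ} [W.IsElliptic]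
    [W.IsGloballyMinimal] (h : CongruentTYZUPlusFamily W) : W.HasCM ∧ CMRamified W 2 := by
  rcases h with ⟨k, p, hp, hinj, -, -, -, C, hC⟩ | ⟨n, hsq, -, -, C, hC⟩ | ⟨p, hp, hinj, -, -, C, hC⟩
  · refine hasCM_and_cmRamified_two_of_smul_congruentNumberCurve ?_ hC
    exact Nat.mul_ne_zero two_ne_zero (squarefree_prod_of_injective p hp hinj).ne_zero
  · exact hasCM_and_cmRamified_two_of_smul_congruentNumberCurve hsq.ne_zero hC
  · exact hasCM_and_cmRamified_two_of_smul_congruentNumberCurve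
      (squarefree_prod_of_injective p hp hinj).ne_zero hC

/-- Every member of `CongruentTYZAtlasFJFamily` has CM with `2` ramified. [folklore] -/
theorem hasCM_and_cmRamified_two_of_congruentTYZAtlasFJFamily {W : WeierstrassCurve ℚ} [W.IsElliptic]
    [W.IsGloballyMinimal] (h : CongruentTYZAtlasFJFamily W) : W.HasCM ∧ CMRamified W 2 := by
  obtain ⟨p, hp, hinj, -, -, -, C, hC⟩ := h
  exact hasCM_and_cmRamified_two_of_smul_congruentNumberCurve
    (squarefree_prod_of_injective p hp hinj).ne_zero hC

end Summit.BirchSwinnertonDyer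

end
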